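import Mathlib
import HarnessLib
import HarnessLib.Audit
import Summits.NavierStokesRegularity.Statement
import Literature.Analysis.FluidPDE.ClassicalSolution
import Literature.Analysis.FluidPDE.LerayHopf
import Literature.Analysis.FluidPDE.SuitableWeak
import Literature.Analysis.FluidPDE.SelfSimilar
import Literature.Analysis.FluidPDE.LocalTypeI
import Summits.NavierStokesRegularity.NavierStokesRegularity.Theorems.TypeICertificateLadderNoBlowupToClay

/-!
Route: MeanFieldTypeI

Route MeanFieldTypeI — realises idea card
NavierStokesRegularity/NavierStokesRegularity/mean-field-alpha-chaotic-dss
("Mean-field theory of a chaotic singularity"). Positive side, Type-I half.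

THESIS X (STATISTICAL TYPE-I LIOUVILLE). It suffices to show: every SCALING-STATIONARY TYPE-I
BLOW-UP STATISTICS is trivial.
Precisely: let mu be a probability measure on path space R -> R^3 -> R^3 (product sigma-algebra)
which is invariant under
every Navier–Stokes scaling u |-> c u(c^2 t, c x), c > 0 (`MeasurePreserving (nsRescale c) mu mu`),
and is concentrated on the
Type-I ancient class K(C,M): ancient mild solutions (nu = 1) on (-inf,0) x R^3, smooth there, with
the Type-I rate
|u(t,x)| <= C/sqrt(-t) and an Albritton–Barker bound typeIBound(slab) u p G <= M < inf for some
suitable pressure p and weak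
gradient G. Then mu-a.e. u vanishes on (-inf,0). Dirac masses at self-similar solutions (Leray
profiles: NRS1996/Tsai1998),
Haar measures on (rotated) discretely self-similar orbits (TypeIDSSLiouvilleConjecture) and
Mailybaev's quasi-periodic /
chaotic renormalised attractors are all special cases of such mu; X is the one statement covering
every recurrence type.

The card's MEAN-FIELD DICHOTOMY is the two-layer plan: write U = E_mu U + U' in similarity
variables; stationarity makes the
mean E_mu U an exactly self-similar field whose profile solves Leray's profile system forced by the
mean fluctuation
nonlinearity (support item MeanProfileEquation, closure-free). Either the fluctuations sustain a
mean flow against the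
exploding wind (a mean-field "dynamo", excluded by crux NoMeanFlow) or the statistics are mean-free
zoom-forced turbulence
(excluded by crux MeanFreeLiouville). NoMeanFlow ∧ MeanFreeLiouville => X (pure logic, checked in
Sketch.lean).

Lean (target decl StatisticalTypeILiouville; elaborates, Sketch.lean rc 0):
∀ (C : ℝ) (M : ENNReal) (μ : MeasureTheory.Measure (ℝ → EuclideanSpace ℝ (Fin 3) → EuclideanSpace ℝ
(Fin 3))), M < ⊤ → MeasureTheory.IsProbabilityMeasure μ → (∀ c : ℝ, 0 < c →
MeasureTheory.MeasurePreserving (Literature.Analysis.FluidPDE.nsRescale c) μ μ) → (∀ᵐ u ∂μ,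
Literature.Analysis.FluidPDE.IsAncientMildSolution 1 u ∧ ContDiffOn ℝ (⊤ : ℕ∞) (Function.uncurry u)
(Set.Iio 0 ×ˢ Set.univ) ∧ Literature.Analysis.FluidPDE.HasTypeITimeDecay C u ∧ ∃ p G,
Literature.Analysis.FluidPDE.IsSuitableWeakSolutionOn (Literature.Analysis.FluidPDE.slab
(EuclideanSpace ℝ (Fin 3)) (Set.Iio 0) isOpen_Iio) 1 0 u p ∧
Literature.Analysis.FluidPDE.HasWeakSpatialGradientOn (Literature.Analysis.FluidPDE.slab
(EuclideanSpace ℝ (Fin 3)) (Set.Iio 0) isOpen_Iio) u G ∧ Literature.Analysis.FluidPDE.typeIBound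
(Set.Iio 0 ×ˢ Set.univ) u p G ≤ M) → ∀ᵐ u ∂μ, ∀ t < 0, ∀ x, u t x = 0

ASSEMBLY X -> NavierStokesRegularity (frame #1): StatisticalTypeILiouville →
TypeIBlowupGivesStatistics → NoTypeII →
NoBlowupToClay → NavierStokesRegularity, PURE LOGIC (theorem assembly_holds in Sketch.lean). Here
TypeIBlowupGivesStatistics
(support glue: a Clay-class Type-I blow-up with no smooth extension yields a NONTRIVIAL
scaling-stationary measure on some
K(C,M)) is, by pure logic (statistics_of_parts in Sketch.lean), the composite of crux
InvariantMeasureReduction (a nontrivial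
element of K(C,M) generates a nontrivial scaling-stationary mu: Krylov–Bogolyubov along the zoom-out
orbit c → ∞,
nontriviality by ε-regularity at large scales + Lin/Albritton–Barker compactness) and support
TypeIBlowupGivesAncient
(AlbrittonBarker2019 Lemma 2.5 + Thm 1.1 forward, KNSS2009 §4, rate inheritance); NoTypeII is the
shared crux
stmt-NavierStokesRegularity-0056 of route TypeILiouville and NoBlowupToClay the shared local-theory
assembly
stmt-NavierStokesRegularity-0055 (verbatim signatures, deduplicated).

Rationale: WHY THIS LINE. Type-I exclusion is a Liouville problem for ancient solutions (KNSS2009,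
AlbrittonBarker2019); what is known
kills only the RIGID recurrence types — fixed points of the similarity flow (Leray profiles:
NecasRuzickaSverak1996,
Tsai1998) and DSS with factor near 1 (ChaeWolf2017RemovingDSS Thm 1.3) — while Mailybaev2013
(arXiv:1210.2494 p.3, p.14)
shows in shell models that renormalised blow-up dynamics is generically quasi-periodic or CHAOTIC,
with laws set by means
over the attractor. This route attacks all recurrence types at once through their invariant measures
(scaling-stationary
statistics, physical variables, in-tree vocabulary: nsRescale, IsAncientMildSolution,
HasTypeITimeDecay, typeIBound) and
imports MEAN-FIELD HYDRODYNAMICS (Krause–Rädler mean-field electrodynamics transplanted through the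
Lamb/Ohm form of the
similarity equation; dictionary: EMF := E_mu[U' x curl U'], wind V = U + y/2, Reynolds forcing
E_mu[(U.grad)U] - (Ubar.grad)Ubar)
to split the statistical Liouville theorem into a DYNAMO EXCLUSION (no mean flow) and a MEAN-FREE
LIOUVILLE (no zero-mean
zoom-forced turbulence). Areas imported: ergodic theory (Krylov–Bogolyubov, stationarity identities:
FMRT2001, Kloeden–
Marin-Rubio–Real doi:10.3934/cpaa.2009.8.785), mean-field MHD/hydrodynamics
(doi:10.1016/j.physrep.2005.06.005,
doi:10.1016/0167-2789(87)90026-1), Type-I compactness (AlbrittonBarker2019, Lin1998, KNSS2009).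
Catalogue moves used:
probabilistic model (invariant measures of a deterministic semiflow) + physical analogy WITH
explicit dictionary.

RANKED CRUXES. #2 MeanFreeLiouville (hardest: no mechanism beyond local energy budgets is known;
linear (zoom) forcing
sustains turbulence in periodic boxes, doi:10.1063/1.2047568, so a proof must use the wind y/2.grad
on R^3 and the trace at infinity).
#3 NoMeanFlow (mean profile = forced Leray system; EMF = 0 => mean = 0 is Tsai1998 Thm 2 via
tsai_selfsimilar_local_energy;
the content is the forced case: alpha-regeneration is paid in fluctuation superhelicity, card
identity (B)).
#4 InvariantMeasureReduction (soft but technical: compact scaling-invariant class in Lin's topology,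
continuity of the cubic
functional C(1,(0,0)) there, Borel section of smooth representatives). #5 NoTypeII (shared with
TypeILiouville, stmt-0056).
Support: TypeIBlowupGivesAncient (AlbrittonBarker2019 Lemma 2.5 + Thm 1.1 fwd; in-tree named fact
AlbrittonBarkerForward),
TypeIBlowupGivesStatistics (glue = reduction ∘ ancient, pure logic), MeanProfileEquation
(closure-free mean-field identity,
provable now), NoBlowupToClay (= stmt-0055), target StatisticalTypeILiouville (= NoMeanFlow ∧
MeanFreeLiouville, pure logic).
Numbers: recurrence types covered by known Liouville theorems = 2 of 4 (fixed point; DSS only for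
lambda in (1, lambda_*(C_*)));
cruxes 4, items 10; negatives index 0 refuted statements (2026-08-15); Sketch.lean rc 0, assembly
proved by pure logic.

KILL CRITERIA. (i) A nontrivial scaling-stationary measure on K(C,M) exhibited (e.g. a Type-I (R)DSS
profile, BradshawTsai2017CPDE
Open Problem 5.1, or a numerically certified chaotic attractor of the Leray-rescaled flow with
Type-I bounds) refutes X and
closes the route (hand the witness to route Blowup). (ii) A Type-I DSS profile with non-zero
log-period mean refutes NoMeanFlow
alone: pivot to X directly. (iii) A zero-mean stationary statistical solution of similarity NS with
Type-I support (even for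
the LINEARISED problem with matched random forcing it calibrates the cost) refutes
MeanFreeLiouville: route closes, the
mean-free chaotic singularity becomes a design brief for the negative side. (iv) Any Type-II blow-up
from Schwartz data
refutes NoTypeII (= not Clay A).

DELIBERATELY NOT DECOMPOSED. The alpha/beta bookkeeping inside NoMeanFlow (EMF–superhelicity law (B)
of the card, tail
functionals Phi_inf, F_inf), the budget/wind mechanism inside MeanFreeLiouville, the
measure-theoretic plumbing of the
reduction (ergodic decomposition is not needed: X is stated for all invariant mu), and everything
Type II.
Prior-programme inspiration notes: not read (plancard mode).

Novelty: Searched (2026-08-15): lit search crossref "stationary statistical solutions Navier-Stokes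
self-similar Type I singularity Liouville ancient invariant measure" (12 rows: FMRT2001 ch. IV
doi:10.1017/cbo9780511546754.005; Foias–Temam 1983 doi:10.1007/bf01205502 self-similar universal
homogeneous statistical solutions — FORWARD-time decaying turbulence, not blow-up; Chae–Wolf 2017
doi:10.1007/s00205-017-1110-7 Liouville for self-similar profiles; Kloeden–Marin-Rubio–Real
doi:10.3934/cpaa.2009.8.785 invariant measures = stationary statistical solutions); crossref
"mean-field hydrodynamics vorticity alpha effect helical turbulence large-scale instability"
(Elperin–Kleeorin–Rogachevskii doi:10.1103/physreve.68.016311, v.Rekowski–Kitchatinov–Rüdiger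
doi:10.1007/bfb0102434, Frisch–She–Sulem AKA doi:10.1142/9789814434348_0044 and
doi:10.1016/0167-2789(87)90026-1); crossref "invariant measure similarity variables blow-up
Krylov-Bogoliubov" (only Galaktionov-type gradient-system rescaled equations,
doi:10.1201/b17415-12); the card's own audit (Krause–Rädler doi:10.1515/9783112729694,
Brandenburg–Subramanian doi:10.1016/j.physrep.2005.06.005, Mailybaev arXiv:1210.2494,
arXiv:1203.2093); in-tree: AlbrittonBarker2019 (arXiv:1811.00502 Thm 1.1, Lemma 2.5, Rem 3.2 read),
KNSS2009, TypeIDSSLiouvilleConjecture, the 7 route files of the sub and ~115 idea cards (siblings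
recurrent-type-i-profiles = ergodic reduction in similarity variables, self-dynamo-hubble-flow =
deterministic dynamo dictiona  [refs: 10.1017/cbo9780511546754.005, 10.1007/bf01205502, 10.1007/s00205-017-1110-7, 10.3934/cpaa.2009.8.785, 10.1103/physreve.68.016311, 10.1007/bfb0102434, 10.1142/9789814434348_0044, 10.1016/0167-2789(87, 10.1201/b17415-12, 10.1515/9783112729694, 10.1016/j.physrep.2005.06.005, 1210.2494, 1203.2093, 1811.00502, doi:10.1017/cbo9780511546754.005, doi:10.1007/bf01205502, doi:10.1007/s00205-017-1110-7, doi:]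

Barriers (technique_class: invariant-measure mean-field-dynamo type-I-blowup-rate): technique_class: invariant-measure mean-field-dynamo type-I-blowup-rate
- Literature.Barriers.NavierStokesRegularity.TaoAveragedBlowup: Tao's averaged blow-up is Type II
(arXiv:1402.0290 p.8 fn.), so it is no counterexample to X; but a proof of MeanFreeLiouville by
abstract energy/function-space estimates would transfer to averaged Type-I statistics if such
existed — NOT evaded in substance for crux #2 (flagged in its why_might_fail: the proof must use the
physical-space wind y/2·grad, the local energy flux form and trace functionals at infinity,
structure absent for B~); NoMeanFlow and MeanProfileEquation live on the Lamb-vector/transport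
structure (mean of (U·grad)U, EMF = E[U' x curl U'], helicity law), which averaged bilinear forms do
not carry. NoTypeII (shared) sits fully in this barrier's shadow, as recorded on route
TypeILiouville.
- Literature.Barriers.NavierStokesRegularity.TruncatedDyadicTypeIBlowup: the sharpest catalogued
test for this route — the exogenously truncated dyadic model blows up at exactly the Type-I rate
with bounded sup-in-scale critical amplitude and exact discrete self-similarity from the second mode
on (machine-checked facet), so any argument insensitive to AUTONOMY and to the fine structure of the
nonlinearity cannot prove X, NoMeanFlow or MeanFreeLiouville. Evaded in form along the entry's own
line: the object of the route does not exist for the witness — a piecewise-constant-in-time coupling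
B~(t) has no scaling semigroup acting on a fixed sol

sub-problem: NavierStokesRegularity · status: done · opened planner-plancard-NavierStokesRegularity-Navie-87c076f9-0 2026-08-15T10:58:07Z · rev 1 · ledger route-NavierStokesRegularity-MeanFieldTypeI
GENERATED by the gate from the ledger (D-0016/17). Provers cite these decls: `theorem foo : Summit.NavierStokesRegularity.NavierStokesRegularity.Theses.MeanFieldTypeI.<Decl> := …` in Summits/NavierStokesRegularity/NavierStokesRegularity/Theorems/<Name>.lean.
-/

namespace Summit.NavierStokesRegularity.NavierStokesRegularity.Theses.MeanFieldTypeI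

open scoped BigOperators Topology Manifold Classical MeasureTheory ProbabilityTheory Matrix InnerProductSpace ComplexConjugate ContinuousMap
open Filter Set Function TopologicalSpace MeasureTheory

attribute [summit_statement] _root_.NavierStokesRegularity

open Literature.NS

/-- item stmt-NavierStokesRegularity-1681 · target · rank 0 · closed · proved by Summit.NavierStokesRegularity.NavierStokesRegularity.Theorems.meanFieldTypeI_statisticalTypeILiouville_vacuous (prover) · by planner
why it might fail: VACUOUS AS FORMALISED: no probability measure on the product σ-algebra of ℝ→ℝ³→ℝ³ is a.e. carried by K(C,M) (measurable sets depend on countably many coordinates; Vacuity.lean rc 0), so X is provable with no content; the intended X dies on one Type-I DSS profile (open: BradshawTsai2017CPDE).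
sources: BradshawTsai2017CPDE, ChaeWolf2017RemovingDSS, Tsai2018, arXiv:1210.2494, AlbrittonBarker2019, Tsai1998
[target] STATISTICAL TYPE-I LIOUVILLE: every probability measure on path space R -> R3 -> R3 that is
invariant under all NS scalings nsRescale c (c>0) and concentrated on the Type-I ancient class
K(C,M) (ancient mild, nu=1, smooth on (-inf,0)xR3, |u| <= C/sqrt(-t), Albritton-Barker
typeIBound(slab) u p G <= M < inf for some suitable pressure p and weak gradient G) is carried by
the zero solution (mu-a.e. u = 0 on t<0). Special cases: Dirac at a Leray self-similar solution
(NRS1996/Tsai1998), Haar measure on a (rotated) Type-I DSS orbit (TypeIDSSLiouvilleConjecture,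
BradshawTsai2017CPDE Open Problem 5.1), Mailybaev's quasi-periodic/chaotic renormalised attractors
(arXiv:1210.2494). = NoMeanFlow ∧ MeanFreeLiouville (target_of_cruxes, Sketch.lean). -/
@[route_item "route-NavierStokesRegularity-MeanFieldTypeI"]
def StatisticalTypeILiouville : Prop :=
  ∀ (C : ℝ) (M : ENNReal) (μ : MeasureTheory.Measure (ℝ → EuclideanSpace ℝ (Fin 3) → EuclideanSpace ℝ (Fin 3))), M < ⊤ → MeasureTheory.IsProbabilityMeasure μ → (∀ c : ℝ, 0 < c → MeasureTheory.MeasurePreserving (Literature.Analysis.FluidPDE.nsRescale c) μ μ) → (∀ᵐ u ∂μ, Literature.Analysis.FluidPDE.IsAncientMildSolution 1 u ∧ ContDiffOn ℝ (⊤ : ℕ∞) (Function.uncurry u) (Set.Iio 0 ×ˢ Set.univ) ∧ Literature.Analysis.FluidPDE.HasTypeITimeDecay C u ∧ ∃ p G, Literature.Analysis.FluidPDE.IsSuitableWeakSolutionOn (Literature.Analysis.FluidPDE.slab (EuclideanSpace ℝ (Fin 3)) (Set.Iio 0) isOpen_Iio) 1 0 u p ∧ Literature.Analysis.FluidPDE.HasWeakSpatialGradientOn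 (Literature.Analysis.FluidPDE.slab (EuclideanSpace ℝ (Fin 3)) (Set.Iio 0) isOpen_Iio) u G ∧ Literature.Analysis.FluidPDE.typeIBound (Set.Iio 0 ×ˢ Set.univ) u p G ≤ M) → ∀ᵐ u ∂μ, ∀ t < 0, ∀ x, u t x = 0

-- `StatisticalTypeILiouville` holds: proved by `Summit.NavierStokesRegularity.NavierStokesRegularity.Theorems.meanFieldTypeI_statisticalTypeILiouville_vacuous` (its module imports this route file, so no `_holds` link can be stated here).

/-- item stmt-NavierStokesRegularity-1684 · crux · rank 4 · open · by planner
why it might fail: Its ∃μ-conclusion is unsatisfiable as formalised (no probability measure on the product σ-algebra is a.e. carried by K(C,M); Vacuity.lean), so the item ≡ deterministic Type-I Liouville for every recurrence type: one Type-I λ-DSS profile (open: BradshawTsai2017CPDE; ChaeWolf2017 only λ≈1) kills it.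
sources: BradshawTsai2017CPDE, ChaeWolf2017RemovingDSS, Tsai2018, AlbrittonBarker2019, KNSS2009, NecasRuzickaSverak1996
[crux] INVARIANT-MEASURE REDUCTION: a non-trivial element v of K(C,M) generates a NON-TRIVIAL
scaling-stationary probability measure concentrated on K(C,M) (same C, M). Road map: the zoom-out
orbit c |-> nsRescale c v, c >= 1, stays in K(C,M) (all conjuncts are scale-invariant); K(C,M) is
compact metrisable for Lin's topology (strong L3 on every parabolic cylinder of the closed slab,
AlbrittonBarker2019 Lemma 2.2 = Lin1998 Thm 2.2; limits stay ancient mild by KNSS2009 compactness,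
smooth by |u| <= C/sqrt(-t) + KNSS2009 §4, typeIBound <= M by lower semicontinuity);
Krylov–Bogolyubov for the continuous R-action tau |-> nsRescale (e^tau) gives an invariant Borel
measure as a limit point of (1/S) int_0^S delta_{nsRescale(e^tau) v} dtau; push it to the product
sigma-algebra through the (continuous) smooth-representative evaluations. NON-TRIVIALITY: F(u) =
int_{Q_{1/2}(0,0)} |u|^3 is continuous on K(C,M) in Lin's topology (uniform L^{10/3} from A+E <= M)
and F(nsRescale R v) = C(R/2,(0,0); v)/4 stays >= eps for large R, else eps-regularity + persistence
of regularity (AlbrittonBarker2019 Prop 2.3, RusinSverak2011) along R_k -> inf forces v = 0.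
Sources: AlbrittonBarker2019 (arXiv:1811.00 -/
@[route_item "route-NavierStokesRegularity-MeanFieldTypeI"]
def InvariantMeasureReduction : Prop :=
  ∀ (C : ℝ) (M : ENNReal), M < ⊤ → ∀ v : ℝ → EuclideanSpace ℝ (Fin 3) → EuclideanSpace ℝ (Fin 3), (Literature.Analysis.FluidPDE.IsAncientMildSolution 1 v ∧ ContDiffOn ℝ (⊤ : ℕ∞) (Function.uncurry v) (Set.Iio 0 ×ˢ Set.univ) ∧ Literature.Analysis.FluidPDE.HasTypeITimeDecay C v ∧ ∃ p G, Literature.Analysis.FluidPDE.IsSuitableWeakSolutionOn (Literature.Analysis.FluidPDE.slab (EuclideanSpace ℝ (Fin 3)) (Set.Iio 0) isOpen_Iio) 1 0 v p ∧ Literature.Analysis.FluidPDE.HasWeakSpatialGradientOn (Literature.Analysis.FluidPDE.slab (EuclideanSpace ℝ (Fin 3)) (Set.Iio 0) isOpen_Iio) v G ∧ Literature.Analysis.FluidPDE.typeIBound (Set.Iio 0 ×ˢ Set.univ) v p G ≤ M) → ¬ (∀ t < 0, ∀ x, v t x = 0) → ∃ μ : MeasureTheory.Measure (ℝ → EuclideanSpace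 ℝ (Fin 3) → EuclideanSpace ℝ (Fin 3)), MeasureTheory.IsProbabilityMeasure μ ∧ (∀ c : ℝ, 0 < c → MeasureTheory.MeasurePreserving (Literature.Analysis.FluidPDE.nsRescale c) μ μ) ∧ (∀ᵐ u ∂μ, Literature.Analysis.FluidPDE.IsAncientMildSolution 1 u ∧ ContDiffOn ℝ (⊤ : ℕ∞) (Function.uncurry u) (Set.Iio 0 ×ˢ Set.univ) ∧ Literature.Analysis.FluidPDE.HasTypeITimeDecay C u ∧ ∃ p G, Literature.Analysis.FluidPDE.IsSuitableWeakSolutionOn (Literature.Analysis.FluidPDE.slab (EuclideanSpace ℝ (Fin 3)) (Set.Iio 0) isOpen_Iio) 1 0 u p ∧ Literature.Analysis.FluidPDE.HasWeakSpatialGradientOn (Literature.Analysis.FluidPDE.slab (EuclideanSpace ℝ (Fin 3)) (Set.Iio 0) isOpen_Iio) u G ∧ Literature.Analysis.FluidPDE.typeIBound (Set.Iio 0 ×ˢ Set.univ) u p G ≤ M) ∧ ¬ (∀ᵐ u ∂μ, ∀ t < 0, ∀ x, u t x = 0)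

/-- item stmt-NavierStokesRegularity-0056 · crux · rank 5 · open · by planner
why it might fail: No theorem bounds a blow-up rate from above; Tao's averaged-NS blow-up is Type II (arXiv:1402.0290 p.8 fn.) and every axisymmetric singularity is Type II (KNSS2009 p.4), so Hou's axisymmetric candidate (arXiv:2107.06509), if real, refutes it (= not Clay A).
sources: Tao2016AveragedNS, arXiv:1402.0290, KNSS2009, arXiv:0709.3599, Hou2022PotentiallySingularNS, arXiv:2107.06509
If a finite-energy classical solution from a rapidly decaying datum has maximal lifespan T<∞ (no
classical extension past T), then ‖u(t)‖_∞ ≤ C (T−t)^{-1/2} eventually as t↑T (Leray's rate is the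
matching lower bound, leray_blowup_rate_top). The hardest and most informative crux: a
counterexample is a Type II singularity, i.e. ¬(Clay A). Known: lower bound c√ν (T−t)^{-1/2} (Leray
1934 §20); L³ must blow up (ESS 2003, Seregin 2012); only triple-log quantitative gain (Tao 2021). -/
@[route_item "route-NavierStokesRegularity-MeanFieldTypeI"]
def NoTypeII : Prop :=
  ∀ (ν T : ℝ), 0 < ν → 0 < T → ∀ (u : ℝ → EuclideanSpace ℝ (Fin 3) → EuclideanSpace ℝ (Fin 3)) (p : ℝ → EuclideanSpace ℝ (Fin 3) → ℝ), Literature.Analysis.FluidPDE.IsMaximalSmoothSolution ν 0 u p T → Literature.Analysis.FluidPDE.IsLerayHopfOn T ν 0 (u 0) u → Literature.Analysis.FluidPDE.HasRapidSpatialDecay (u 0) → Literature.Analysis.FluidPDE.IsTypeIBlowup u T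

/-- item stmt-NavierStokesRegularity-1682 · support · rank 2 · closed · proved by Summit.NavierStokesRegularity.NavierStokesRegularity.Theorems.meanFieldTypeI_meanFreeLiouville_vacuous (prover) · by planner
why it might fail: Linear forcing DOES sustain turbulence in periodic boxes (doi:10.1063/1.2047568): only the wind y/2·grad on R^3 and transport to infinity can kill zero-mean statistics; no mechanism beyond local energy budgets (barred for abstract estimates, Tao2016AveragedNS) is known.
sources: doi:10.1063/1.2047568, arXiv:1203.2093, arXiv:1210.2494, Tao2016AveragedNS, KNSS2009
[crux] MEAN-FREE STATISTICAL LIOUVILLE: a scaling-stationary Type-I statistics (as in the target)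
whose mean velocity field E_mu[u(t,x)] vanishes identically is trivial. In similarity variables: no
non-trivial zero-mean stationary statistical solution of d_s U = Lap U - U/2 - (y/2).grad U -
(U.grad)U - grad P with Type-I support ('zoom-forced turbulence': the only energy source is the
linear dilation term, input rate fixed by the scaling, against an outward wind of rate 1/2 on R^3).
Contains the zero-mean half of the DSS Liouville problem. Sources: card mean-field-alpha-chaotic-dss
§Mechanism (C),(K3); Lundgren 2003 / Rosales-Meneveau doi:10.1063/1.2047568 (linearly forced
turbulence sustains in a periodic box); Mailybaev arXiv:1203.2093, arXiv:1210.2494; KNSS2009;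
Tao2016AveragedNS (budget-only proofs are barred). -/
@[route_item "route-NavierStokesRegularity-MeanFieldTypeI"]
def MeanFreeLiouville : Prop :=
  ∀ (C : ℝ) (M : ENNReal) (μ : MeasureTheory.Measure (ℝ → EuclideanSpace ℝ (Fin 3) → EuclideanSpace ℝ (Fin 3))), M < ⊤ → MeasureTheory.IsProbabilityMeasure μ → (∀ c : ℝ, 0 < c → MeasureTheory.MeasurePreserving (Literature.Analysis.FluidPDE.nsRescale c) μ μ) → (∀ᵐ u ∂μ, Literature.Analysis.FluidPDE.IsAncientMildSolution 1 u ∧ ContDiffOn ℝ (⊤ : ℕ∞) (Function.uncurry u) (Set.Iio 0 ×ˢ Set.univ) ∧ Literature.Analysis.FluidPDE.HasTypeITimeDecay C u ∧ ∃ p G, Literature.Analysis.FluidPDE.IsSuitableWeakSolutionOn (Literature.Analysis.FluidPDE.slab (EuclideanSpace ℝ (Fin 3)) (Set.Iio 0) isOpen_Iio) 1 0 u p ∧ Literature.Analysis.FluidPDE.HasWeakSpatialGradientOn (Literature.Analysis.FluidPDE.slab (EuclideanSpace ℝ (Fin 3)) (Set.Iio 0) isOpen_Iio) u G ∧ Literature.Analysis.FluidPDE.typeIBound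 (Set.Iio 0 ×ˢ Set.univ) u p G ≤ M) → (∀ t < 0, ∀ x, (∫ u, u t x ∂μ) = 0) → ∀ᵐ u ∂μ, ∀ t < 0, ∀ x, u t x = 0

-- `MeanFreeLiouville` holds: proved by `Summit.NavierStokesRegularity.NavierStokesRegularity.Theorems.meanFieldTypeI_meanFreeLiouville_vacuous` (its module imports this route file, so no `_holds` link can be stated here).

/-- item stmt-NavierStokesRegularity-1683 · support · rank 3 · closed · proved by Summit.NavierStokesRegularity.NavierStokesRegularity.Theorems.meanFieldTypeI_noMeanFlow_vacuous (prover) · by planner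
why it might fail: A Type-I DSS profile with non-zero log-period mean refutes it; no closure-free 'regeneration needs |alpha| >= escape rate' bound for the Reynolds-forced Leray system is known, and the kinematic vorticity alpha-effect vanishes for Galilean-invariant incompressible fluctuations (Krause–Rüdiger 1974).
sources: doi:10.1515/9783112729694, doi:10.1016/j.physrep.2005.06.005, doi:10.1016/0167-2789(87)90026-1, Tsai1998, NecasRuzickaSverak1996, BradshawTsai2017CPDE
[crux] NO MEAN FLOW (dynamo exclusion): the barycentre E_mu[u(t,x)] of a scaling-stationary Type-I
statistics vanishes for all t<0, x. By stationarity the mean is an exactly self-similar field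
lerayBackward (1/2) 0 Phi whose profile solves Leray's system forced by the mean fluctuation
nonlinearity (support MeanProfileEquation); if the forcing (EMF) vanishes, Phi = 0 is Tsai1998 Thm 2
(tsai_selfsimilar_local_energy, local energy bounds from typeIBound <= M by Jensen). Content = the
forced case: fluctuations cannot regenerate a mean vorticity against the exploding wind V = Phi +
y/2; the card's closure-free EMF–superhelicity identity (B) prices alpha-regeneration in viscous
destruction of fluctuation superhelicity. For a DSS orbit measure this says the log-period average
of a Type-I DSS profile is zero. Sources: card §Mechanism (A),(B),(K2); Krause–Rädler
doi:10.1515/9783112729694 ch.5-7; Brandenburg–Subramanian doi:10.1016/j.physrep.2005.06.005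
(alpha-quenching); Frisch–She–Sulem doi:10.1016/0167-2789(87)90026-1 (AKA); Krause–Rüdiger 1974
(vorticity alpha-effect vanishes for Galilean-invariant incompressible fluctuations); Tsai1998;
NecasRuzickaSverak1996. -/
@[route_item "route-NavierStokesRegularity-MeanFieldTypeI"]
def NoMeanFlow : Prop :=
  ∀ (C : ℝ) (M : ENNReal) (μ : MeasureTheory.Measure (ℝ → EuclideanSpace ℝ (Fin 3) → EuclideanSpace ℝ (Fin 3))), M < ⊤ → MeasureTheory.IsProbabilityMeasure μ → (∀ c : ℝ, 0 < c → MeasureTheory.MeasurePreserving (Literature.Analysis.FluidPDE.nsRescale c) μ μ) → (∀ᵐ u ∂μ, Literature.Analysis.FluidPDE.IsAncientMildSolution 1 u ∧ ContDiffOn ℝ (⊤ : ℕ∞) (Function.uncurry u) (Set.Iio 0 ×ˢ Set.univ) ∧ Literature.Analysis.FluidPDE.HasTypeITimeDecay C u ∧ ∃ p G, Literature.Analysis.FluidPDE.IsSuitableWeakSolutionOn (Literature.Analysis.FluidPDE.slab (EuclideanSpace ℝ (Fin 3)) (Set.Iio 0) isOpen_Iio) 1 0 u p ∧ Literature.Analysis.FluidPDE.HasWeakSpatialGradientOn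 (Literature.Analysis.FluidPDE.slab (EuclideanSpace ℝ (Fin 3)) (Set.Iio 0) isOpen_Iio) u G ∧ Literature.Analysis.FluidPDE.typeIBound (Set.Iio 0 ×ˢ Set.univ) u p G ≤ M) → ∀ t < 0, ∀ x, (∫ u, u t x ∂μ) = 0

-- `NoMeanFlow` holds: proved by `Summit.NavierStokesRegularity.NavierStokesRegularity.Theorems.meanFieldTypeI_noMeanFlow_vacuous` (its module imports this route file, so no `_holds` link can be stated here).

/-- item stmt-NavierStokesRegularity-0055 · support · rank 9 · closed · proved by Summit.NavierStokesRegularity.NavierStokesRegularity.Theorems.typeICertificateLadder_noBlowupToClay_proof @ 8d57e70af7e2 (prover) · by planner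
sources: Leray1934, KNSS2009
Given NoBlowup, build the Clay (A) solution: local finite-energy classical solution for smooth
divergence-free rapidly decaying data (Leray 1934 §III / Fujita–Kato 1964 + LPS smoothing), continue
past every T using NoBlowup, glue by weak–strong uniqueness (Prodi–Serrin), bounded energy from the
energy inequality, and convert with
Literature.Analysis.FluidPDE.isNavierStokesSolution_and_smooth_iff. Blow-up at spatial infinity is
excluded by CKN ε-regularity applied far out. May take named Literature facts (leray_existence_R3,
ladyzhenskaya_prodi_serrin, weak_strong_uniqueness, fujita_kato_local) as hypotheses if the grounder
so rules. -/
@[route_item "route-NavierStokesRegularity-MeanFieldTypeI"]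
def NoBlowupToClay : Prop :=
  (∀ (ν T : ℝ), 0 < ν → 0 < T → ∀ (u : ℝ → EuclideanSpace ℝ (Fin 3) → EuclideanSpace ℝ (Fin 3)) (p : ℝ → EuclideanSpace ℝ (Fin 3) → ℝ), Literature.Analysis.FluidPDE.IsClassicalNSSolutionOn (Set.Ico 0 T) ν 0 u p → Literature.Analysis.FluidPDE.IsLerayHopfOn T ν 0 (u 0) u → Literature.Analysis.FluidPDE.HasRapidSpatialDecay (u 0) → Literature.Analysis.FluidPDE.HasSmoothExtensionPast ν 0 u T) → NavierStokesRegularity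

/-- `NoBlowupToClay` holds: proved by `Summit.NavierStokesRegularity.NavierStokesRegularity.Theorems.typeICertificateLadder_noBlowupToClay_proof` @ 8d57e70af7e2. -/
theorem NoBlowupToClay_holds : NoBlowupToClay := _root_.Summit.NavierStokesRegularity.NavierStokesRegularity.Theorems.typeICertificateLadder_noBlowupToClay_proof

/-- item stmt-NavierStokesRegularity-1685 · support · rank 9 · closed · proved by Summit.NavierStokesRegularity.NavierStokesRegularity.Theorems.meanFieldTypeI_typeIBlowupGivesAncient_proof (prover) · by planner
sources: arXiv:1811.00502, arXiv:0709.3599, arXiv:0804.1803, Seregin2012, AlbrittonBarker2019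
[support] TYPE-I BLOW-UP GIVES A NON-TRIVIAL TYPE-I ANCIENT SOLUTION in K(C,M): for a finite-energy
classical solution from a rapidly decaying datum with no smooth extension past T and Type-I rate,
(i) rescale nu to 1; (ii) some (T,x0) is a singular point (else far-field regularity + local
boundedness continue the solution; LerayFarFieldRegularity in tree); (iii) the rate ||u(t)||_inf <=
C(T-t)^{-1/2} is weak Serrin L^{2,inf}_t L^inf_x, so AlbrittonBarker2019 Lemma 2.5 gives
I(Q((T,x0),1/2)) < inf (bound via C(1), D(1), finite for Leray–Hopf) and (T,x0) is a local Type-I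
singular point (IsLocalTypeISingularPoint); (iv) AlbrittonBarker2019 Thm 1.1 forward (in-tree named
fact AlbrittonBarkerForward; Seregin–Šverák arXiv:0804.1803 Thm 2.8 rescaling) yields a non-trivial
bounded ancient mild solution v with suitable pressure, weak gradient and typeIBound(slab) < inf;
(v) v is smooth on the open slab (KNSS2009 §4) and inherits |v(s,y)| <= C/sqrt(-s) because all
rescalings are NS scalings about points of time <= T (A–B Rem 3.2 explains why the L-inf rate alone
would not give I < inf: the finite energy is used in (iii)). May take (h : AlbrittonBarkerForward)
and KNSS regularity facts as h -/
@[route_item "route-NavierStokesRegularity-MeanFieldTypeI"]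
def TypeIBlowupGivesAncient : Prop :=
  ∀ (ν T : ℝ), 0 < ν → 0 < T → ∀ (u : ℝ → EuclideanSpace ℝ (Fin 3) → EuclideanSpace ℝ (Fin 3)) (p : ℝ → EuclideanSpace ℝ (Fin 3) → ℝ), Literature.Analysis.FluidPDE.IsClassicalNSSolutionOn (Set.Ico 0 T) ν 0 u p → Literature.Analysis.FluidPDE.IsLerayHopfOn T ν 0 (u 0) u → Literature.Analysis.FluidPDE.HasRapidSpatialDecay (u 0) → ¬ Literature.Analysis.FluidPDE.HasSmoothExtensionPast ν 0 u T → Literature.Analysis.FluidPDE.IsTypeIBlowup u T → ∃ (C : ℝ) (M : ENNReal) (v : ℝ → EuclideanSpace ℝ (Fin 3) → EuclideanSpace ℝ (Fin 3)), M < ⊤ ∧ (Literature.Analysis.FluidPDE.IsAncientMildSolution 1 v ∧ ContDiffOn ℝ (⊤ : ℕ∞) (Function.uncurry v) (Set.Iio 0 ×ˢ Set.univ) ∧ Literature.Analysis.FluidPDE.HasTypeITimeDecay C v ∧ ∃ p G, Literature.Analysis.FluidPDE.IsSuitableWeakSolutionOn (Literature.Analysis.FluidPDE.slab (EuclideanSpace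 ℝ (Fin 3)) (Set.Iio 0) isOpen_Iio) 1 0 v p ∧ Literature.Analysis.FluidPDE.HasWeakSpatialGradientOn (Literature.Analysis.FluidPDE.slab (EuclideanSpace ℝ (Fin 3)) (Set.Iio 0) isOpen_Iio) v G ∧ Literature.Analysis.FluidPDE.typeIBound (Set.Iio 0 ×ˢ Set.univ) v p G ≤ M) ∧ ¬ (∀ t < 0, ∀ x, v t x = 0)

-- `TypeIBlowupGivesAncient` holds: proved by `Summit.NavierStokesRegularity.NavierStokesRegularity.Theorems.meanFieldTypeI_typeIBlowupGivesAncient_proof` (its module imports this route file, so no `_holds` link can be stated here).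

/-- item stmt-NavierStokesRegularity-1686 · support · rank 9 · open · by planner
sources: arXiv:1811.00502, arXiv:0709.3599, FMRT2001
[support] GLUE: TYPE-I BLOW-UP GIVES NON-TRIVIAL TYPE-I STATISTICS — a finite-energy classical
solution from a rapidly decaying datum with no smooth extension past T and Type-I rate yields, for
some C and M < inf, a NON-TRIVIAL scaling-stationary probability measure concentrated on K(C,M).
Pure-logic composite of support TypeIBlowupGivesAncient (Clay-class Type-I blow-up ⇒ non-trivial v
in K(C,M)) and crux InvariantMeasureReduction (non-trivial v ⇒ non-trivial scaling-stationary mu),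
proved as statistics_of_parts in the planner's Sketch.lean; it is the assembly's second hypothesis.
Sources: AlbrittonBarker2019 (arXiv:1811.00502), KNSS2009 (arXiv:0709.3599), FMRT2001 ch. IV. -/
@[route_item "route-NavierStokesRegularity-MeanFieldTypeI"]
def TypeIBlowupGivesStatistics : Prop :=
  ∀ (ν T : ℝ), 0 < ν → 0 < T → ∀ (u : ℝ → EuclideanSpace ℝ (Fin 3) → EuclideanSpace ℝ (Fin 3)) (p : ℝ → EuclideanSpace ℝ (Fin 3) → ℝ), Literature.Analysis.FluidPDE.IsClassicalNSSolutionOn (Set.Ico 0 T) ν 0 u p → Literature.Analysis.FluidPDE.IsLerayHopfOn T ν 0 (u 0) u → Literature.Analysis.FluidPDE.HasRapidSpatialDecay (u 0) → ¬ Literature.Analysis.FluidPDE.HasSmoothExtensionPast ν 0 u T → Literature.Analysis.FluidPDE.IsTypeIBlowup u T → ∃ (C : ℝ) (M : ENNReal) (μ : MeasureTheory.Measure (ℝ → EuclideanSpace ℝ (Fin 3) → EuclideanSpace ℝ (Fin 3))), M < ⊤ ∧ MeasureTheory.IsProbabilityMeasure μ ∧ (∀ c : ℝ, 0 < c → MeasureTheory.MeasurePreserving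 (Literature.Analysis.FluidPDE.nsRescale c) μ μ) ∧ (∀ᵐ u ∂μ, Literature.Analysis.FluidPDE.IsAncientMildSolution 1 u ∧ ContDiffOn ℝ (⊤ : ℕ∞) (Function.uncurry u) (Set.Iio 0 ×ˢ Set.univ) ∧ Literature.Analysis.FluidPDE.HasTypeITimeDecay C u ∧ ∃ p G, Literature.Analysis.FluidPDE.IsSuitableWeakSolutionOn (Literature.Analysis.FluidPDE.slab (EuclideanSpace ℝ (Fin 3)) (Set.Iio 0) isOpen_Iio) 1 0 u p ∧ Literature.Analysis.FluidPDE.HasWeakSpatialGradientOn (Literature.Analysis.FluidPDE.slab (EuclideanSpace ℝ (Fin 3)) (Set.Iio 0) isOpen_Iio) u G ∧ Literature.Analysis.FluidPDE.typeIBound (Set.Iio 0 ×ˢ Set.univ) u p G ≤ M) ∧ ¬ (∀ᵐ u ∂μ, ∀ t < 0, ∀ x, u t x = 0)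

/-- item stmt-NavierStokesRegularity-1687 · support · rank 9 · closed · proved by Summit.NavierStokesRegularity.NavierStokesRegularity.Theorems.meanFieldTypeI_meanProfileEquation_vacuous (prover) · by planner
sources: doi:10.1515/9783112729694, FMRT2001, NecasRuzickaSverak1996, Tsai1998, KNSS2009
[support] MEAN PROFILE EQUATION (closure-free mean-field identity, provable now): for a
scaling-stationary Type-I statistics the mean field E_mu[u(t,x)] is smooth, exactly self-similar, =
lerayBackward (1/2) 0 Phi with Phi(y) = E_mu[u(-1,y)], div Phi = 0, and Phi solves Leray's profile
system (nu=1, a=1/2) with the MEAN nonlinearity: -Lap Phi + Phi/2 + (1/2)(y.grad)Phi +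
E_mu[(u(-1).grad)u(-1)] + grad Pr = 0 for a smooth Pr. Proof sketch: mu-a.e. u is a classical NS
solution on the open slab with |u|,|grad u|,|d_t u|,|grad p| bounded on t <= -delta uniformly over
K(C,M) (KNSS2009 §4 estimates from |u| <= C/sqrt(-t)); exchange E_mu with derivatives (dominated),
use scaling-stationarity E_mu[nsRescale c u] = E_mu[u] to get self-similarity of the mean and the
vanishing of the E_mu[d_s U] term, and write E_mu[grad p] as a gradient via p normalised at x=0
(mild pressure = Riesz transforms, pinned by typeIBound < inf). Equivalent Lamb/Ohm form: V x
Omega_bar + EMF - curl Omega_bar = grad Pi_bar with EMF = E_mu[U' x curl U'] (card (A)); EMF = 0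
reduces NoMeanFlow to tsai_selfsimilar_local_energy. Sources: card §Mechanism; Krause–Rädler
doi:10.1515/9783112729694 (mean-field equations); FMR -/
@[route_item "route-NavierStokesRegularity-MeanFieldTypeI"]
def MeanProfileEquation : Prop :=
  ∀ (C : ℝ) (M : ENNReal) (μ : MeasureTheory.Measure (ℝ → EuclideanSpace ℝ (Fin 3) → EuclideanSpace ℝ (Fin 3))), M < ⊤ → MeasureTheory.IsProbabilityMeasure μ → (∀ c : ℝ, 0 < c → MeasureTheory.MeasurePreserving (Literature.Analysis.FluidPDE.nsRescale c) μ μ) → (∀ᵐ u ∂μ, Literature.Analysis.FluidPDE.IsAncientMildSolution 1 u ∧ ContDiffOn ℝ (⊤ : ℕ∞) (Function.uncurry u) (Set.Iio 0 ×ˢ Set.univ) ∧ Literature.Analysis.FluidPDE.HasTypeITimeDecay C u ∧ ∃ p G, Literature.Analysis.FluidPDE.IsSuitableWeakSolutionOn (Literature.Analysis.FluidPDE.slab (EuclideanSpace ℝ (Fin 3)) (Set.Iio 0) isOpen_Iio) 1 0 u p ∧ Literature.Analysis.FluidPDE.HasWeakSpatialGradientOn (Literature.Analysis.FluidPDE.slab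 (EuclideanSpace ℝ (Fin 3)) (Set.Iio 0) isOpen_Iio) u G ∧ Literature.Analysis.FluidPDE.typeIBound (Set.Iio 0 ×ˢ Set.univ) u p G ≤ M) → ∃ (Φ : EuclideanSpace ℝ (Fin 3) → EuclideanSpace ℝ (Fin 3)) (Pr : EuclideanSpace ℝ (Fin 3) → ℝ), ContDiff ℝ (⊤ : ℕ∞) Φ ∧ ContDiff ℝ (⊤ : ℕ∞) Pr ∧ Literature.Analysis.FluidPDE.VectorCalculus.IsDivFree Φ ∧ (∀ t < 0, ∀ x, (∫ u, u t x ∂μ) = Literature.Analysis.FluidPDE.lerayBackward (1 / 2 : ℝ) 0 Φ t x) ∧ ∀ y, -(Laplacian.laplacian Φ y) + (1 / 2 : ℝ) • Φ y + (1 / 2 : ℝ) • fderiv ℝ Φ y y + (∫ u, Literature.Analysis.FluidPDE.convect (u (-1)) (u (-1)) y ∂μ) + gradient Pr y = 0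

-- `MeanProfileEquation` holds: proved by `Summit.NavierStokesRegularity.NavierStokesRegularity.Theorems.meanFieldTypeI_meanProfileEquation_vacuous` (its module imports this route file, so no `_holds` link can be stated here).

/-- item stmt-NavierStokesRegularity-1688 · assembly · rank 1 · closed · proved by Summit.NavierStokesRegularity.NavierStokesRegularity.Theorems.meanFieldTypeI_assembly_proof (prover) · by planner
sources: AlbrittonBarker2019, KNSS2009
[assembly] StatisticalTypeILiouville → TypeIBlowupGivesStatistics → NoTypeII → NoBlowupToClay →
NavierStokesRegularity (frame #1: X → Statement). PURE LOGIC (theorem assembly_holds in the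
planner's Sketch.lean): to get Clay (A) apply NoBlowupToClay; given a finite-energy classical
solution from Clay data, if it had no smooth extension past T it is maximal (IsMaximalSmoothSolution
= classical ∧ no extension), NoTypeII gives the Type-I rate, TypeIBlowupGivesStatistics a
non-trivial scaling-stationary mu on some K(C,M) with M < inf, and StatisticalTypeILiouville (=
NoMeanFlow ∧ MeanFreeLiouville) says mu is trivial — contradiction. -/
@[route_item "route-NavierStokesRegularity-MeanFieldTypeI"]
def Assembly : Prop :=
  (∀ (C : ℝ) (M : ENNReal) (μ : MeasureTheory.Measure (ℝ → EuclideanSpace ℝ (Fin 3) → EuclideanSpace ℝ (Fin 3))), M < ⊤ → MeasureTheory.IsProbabilityMeasure μ → (∀ c : ℝ, 0 < c → MeasureTheory.MeasurePreserving (Literature.Analysis.FluidPDE.nsRescale c) μ μ) → (∀ᵐ u ∂μ, Literature.Analysis.FluidPDE.IsAncientMildSolution 1 u ∧ ContDiffOn ℝ (⊤ : ℕ∞) (Function.uncurry u) (Set.Iio 0 ×ˢ Set.univ) ∧ Literature.Analysis.FluidPDE.HasTypeITimeDecay C u ∧ ∃ p G, Literature.Analysis.FluidPDE.IsSuitableWeakSolutionOn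 (Literature.Analysis.FluidPDE.slab (EuclideanSpace ℝ (Fin 3)) (Set.Iio 0) isOpen_Iio) 1 0 u p ∧ Literature.Analysis.FluidPDE.HasWeakSpatialGradientOn (Literature.Analysis.FluidPDE.slab (EuclideanSpace ℝ (Fin 3)) (Set.Iio 0) isOpen_Iio) u G ∧ Literature.Analysis.FluidPDE.typeIBound (Set.Iio 0 ×ˢ Set.univ) u p G ≤ M) → ∀ᵐ u ∂μ, ∀ t < 0, ∀ x, u t x = 0) → (∀ (ν T : ℝ), 0 < ν → 0 < T → ∀ (u : ℝ → EuclideanSpace ℝ (Fin 3) → EuclideanSpace ℝ (Fin 3)) (p : ℝ → EuclideanSpace ℝ (Fin 3) → ℝ), Literature.Analysis.FluidPDE.IsClassicalNSSolutionOn (Set.Ico 0 T) ν 0 u p → Literature.Analysis.FluidPDE.IsLerayHopfOn T ν 0 (u 0) u → Literature.Analysis.FluidPDE.HasRapidSpatialDecay (u 0) → ¬ Literature.Analysis.FluidPDE.HasSmoothExtensionPast ν 0 u T → Literature.Analysis.FluidPDE.IsTypeIBlowup u T → ∃ (C : ℝ) (M : ENNReal) (μ : MeasureTheory.Measure (ℝ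 → EuclideanSpace ℝ (Fin 3) → EuclideanSpace ℝ (Fin 3))), M < ⊤ ∧ MeasureTheory.IsProbabilityMeasure μ ∧ (∀ c : ℝ, 0 < c → MeasureTheory.MeasurePreserving (Literature.Analysis.FluidPDE.nsRescale c) μ μ) ∧ (∀ᵐ u ∂μ, Literature.Analysis.FluidPDE.IsAncientMildSolution 1 u ∧ ContDiffOn ℝ (⊤ : ℕ∞) (Function.uncurry u) (Set.Iio 0 ×ˢ Set.univ) ∧ Literature.Analysis.FluidPDE.HasTypeITimeDecay C u ∧ ∃ p G, Literature.Analysis.FluidPDE.IsSuitableWeakSolutionOn (Literature.Analysis.FluidPDE.slab (EuclideanSpace ℝ (Fin 3)) (Set.Iio 0) isOpen_Iio) 1 0 u p ∧ Literature.Analysis.FluidPDE.HasWeakSpatialGradientOn (Literature.Analysis.FluidPDE.slab (EuclideanSpace ℝ (Fin 3)) (Set.Iio 0) isOpen_Iio) u G ∧ Literature.Analysis.FluidPDE.typeIBound (Set.Iio 0 ×ˢ Set.univ) u p G ≤ M) ∧ ¬ (∀ᵐ u ∂μ, ∀ t < 0, ∀ x, u t x = 0)) → (∀ (ν T : ℝ),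 0 < ν → 0 < T → ∀ (u : ℝ → EuclideanSpace ℝ (Fin 3) → EuclideanSpace ℝ (Fin 3)) (p : ℝ → EuclideanSpace ℝ (Fin 3) → ℝ), Literature.Analysis.FluidPDE.IsMaximalSmoothSolution ν 0 u p T → Literature.Analysis.FluidPDE.IsLerayHopfOn T ν 0 (u 0) u → Literature.Analysis.FluidPDE.HasRapidSpatialDecay (u 0) → Literature.Analysis.FluidPDE.IsTypeIBlowup u T) → ((∀ (ν T : ℝ), 0 < ν → 0 < T → ∀ (u : ℝ → EuclideanSpace ℝ (Fin 3) → EuclideanSpace ℝ (Fin 3)) (p : ℝ → EuclideanSpace ℝ (Fin 3) → ℝ), Literature.Analysis.FluidPDE.IsClassicalNSSolutionOn (Set.Ico 0 T) ν 0 u p → Literature.Analysis.FluidPDE.IsLerayHopfOn T ν 0 (u 0) u → Literature.Analysis.FluidPDE.HasRapidSpatialDecay (u 0) → Literature.Analysis.FluidPDE.HasSmoothExtensionPast ν 0 u T) → NavierStokesRegularity) → NavierStokesRegularity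

-- `Assembly` holds: proved by `Summit.NavierStokesRegularity.NavierStokesRegularity.Theorems.meanFieldTypeI_assembly_proof` (its module imports this route file, so no `_holds` link can be stated here).

end Summit.NavierStokesRegularity.NavierStokesRegularity.Theses.MeanFieldTypeI
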